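import Summits.Ventures.CertifiedManyBodySolver.Certificates.HubbardSquare_tpm3o10_U29o5_toyKernelCert_bondRow
import HarnessLib

/-!
# STEP-0 of «tier P», fourth toy: the ENERGY-ROW slots of the kernel form exercised end to end — the mean-energy identity
# `Re ω(Γ E_Φ) = e₀(1, −3/10, 29/5; x)` for every torus-limit ground state of density `x`, from the two one-line certificates
# `E_Φ − 1·(E_Φ − lo·1) = lo·1` (floor multiplier `κlo = 1`) and `−E_Φ − 1·(hi·1 − E_Φ) = −hi·1` (cap multiplier `κhi = 1`),
# replayed in the kernel with the mean-energy DICTIONARY `termOp_energyTermsIdx` — ZERO hypotheses, NO claim node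

HONEST FRAMING: a TOY (the identity is the tree's `IsTorusLimitOf.meanEnergy_hubbardTTPrime_eq_energyDensityTT'`, here re-obtained
THROUGH the certificate pipeline as a consistency check); it exercises the last two slots of `affineOrbitLowerRowN_of_kernelCert` not
touched by the first three toys (`…_pauliRow`: SOS factor; `…_bondRow`: translation move + density row; `…_currentRow`: eom family):
the energy multipliers `κhi`, `κlo` with their levels and the embedded mean-energy term list `TE = energyTermsIdx 1 (−3/10) (29/5) ix`
(33 terms; the normaliser cancels `TE` against itself and leaves the constant). Trust base: the Lean kernel (std axioms). No number
of record; no existing claim node discharged; CONTROL/CALIBRATION context (wording (xx1)); silent on ρ_s = 0 / presence / T_c /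
phase; nothing about La₂CuO₄; no summit statement is proved by this file. Seat hubbard-obs-p2 (STIFFNESS), `prover-hubbard-obs-p2-g22-0`,
zero compute.

References: J. Wang et al., PRX 14 (2024) 031006 §III (the energy constraint in the relaxation) [WangEtAl2024]; O. Bratteli,
A. Kishimoto, D. W. Robinson, CMP 64 (1978) 41 §3 [BratteliKishimotoRobinson1978].
-/

noncomputable section

namespace Summit.Ventures.CertifiedManyBodySolver

namespace CARPolyWindow

namespace Toy3x3

open Summit.Ventures.CertifiedQuantumChemistry Summit.Ventures.CertifiedQuantumChemistry.CARPoly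
open Literature.MathematicalPhysics.QuantumLattice Literature.MathematicalPhysics.QuantumLattice.HubbardWave0
open Literature.MathematicalPhysics.QuantumManyBody.StateRelaxation
open Literature.Probability.LatticeModels ThermodynamicLimit Filter Topology
open Matrix
open scoped ComplexOrder BigOperators

/-! ## The two certificates -/

/-- Residual of the FLOOR certificate: objective `E_Φ` (`TE`), `κlo = 1` at level `lo = −2`, nothing else ⇒ `TE − (TE − (−2)·1) = −2·1`.
[cite: WangEtAl2024, §III] -/
def enResidLo : Terms (Orb (Fin 9)) :=
  residT TE (fun _ => 0) 0 (fun σ => orb 0 σ) 0 0 1 (-2) TE 0 [] TH fb [] (fun l : Fin 0 => l.elim0) (fun l : Fin 0 => l.elim0) [] []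

/-- Residual of the CAP certificate: objective `−E_Φ`, `κhi = 1` at level `hi = 2` ⇒ `−TE − (2·1 − TE) = −2·1`. [cite: WangEtAl2024, §III] -/
def enResidHi : Terms (Orb (Fin 9)) :=
  residT (negT TE) (fun _ => 0) 0 (fun σ => orb 0 σ) 1 2 0 0 TE 0 [] TH fb [] (fun l : Fin 0 => l.elim0) (fun l : Fin 0 => l.elim0)
    [] []

/-- **Kernel evaluation (floor certificate)**: `−2 ≤ lowerConst (normalize enResidLo)` (`= −2`: the 33 mean-energy terms cancel).
[cite: WangEtAl2024, §III] -/
theorem en_lowerConst_lo : (-2 : ℚ) ≤ lowerConst (CARPoly.normalize enc 32 enResidLo) + ((0 : ℚ) + 0) * ((7 / 8 : ℚ) / 2 - 0) := by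
  decide +kernel

/-- **Kernel evaluation (cap certificate)**: `−2 ≤ lowerConst (normalize enResidHi)`. [cite: WangEtAl2024, §III] -/
theorem en_lowerConst_hi : (-2 : ℚ) ≤ lowerConst (CARPoly.normalize enc 32 enResidHi) + ((0 : ℚ) + 0) * ((7 / 8 : ℚ) / 2 - 0) := by
  decide +kernel

/-! ## The end-to-end theorem -/

/-- Membership-proof irrelevance for ordered sites. [folklore] -/
private theorem pt_congr_site₄ {x y : Site 2} (hx : x ∈ W) (hy : y ∈ W) (h : x = y) :
    PolySite.pt x hx = PolySite.pt y hy := by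
  subst h; rfl

/-- The common discharge of the kernel form's side conditions on the `3 × 3` window (letters, dictionaries, geometry), for a
certificate with NO Gram / eom / move / charged / anti-Hermitian family: objective `TX`, energy slots `(κhi, hi, κlo, lo)`, value `q`.
[cite: WangEtAl2024, §III] -/
theorem affineOrbitLowerRowN_energyOnly (TX : Terms (Orb (Fin 9))) (κhi hi κlo lo q : ℚ)
    (hq : q ≤ lowerConst (CARPoly.normalize enc 32
      (residT TX (fun _ => 0) 0 (fun σ => orb 0 σ) κhi hi κlo lo TE 0 [] TH fb [] (fun l : Fin 0 => l.elim0)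
        (fun l : Fin 0 => l.elim0) [] [])) + ((0 : ℚ) + 0) * ((7 / 8 : ℚ) / 2 - 0)) :
    SquareTTPrimeCorrAffineOrbitLowerRowN (((-3 / 10 : ℚ)) : ℝ) (((29 / 5 : ℚ)) : ℝ) q hi lo κhi κlo 0 (7 / 8) {1} W (termOp d TX) := by
  have hz : (0 : Site 2) ∈ W := zero_mem_thicken_zero 1
  have h1 : (1 : DihedralGroup 4) ∈ ({1} : Finset (DihedralGroup 4)) := Finset.mem_singleton_self 1
  have hmul : ∀ a ∈ ({1} : Finset (DihedralGroup 4)), ∀ b ∈ ({1} : Finset (DihedralGroup 4)),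
      a * b ∈ ({1} : Finset (DihedralGroup 4)) := by
    intro a ha b hb
    rw [Finset.mem_singleton] at ha hb ⊢
    rw [ha, hb, mul_one]
  have hΛ : ({0} : Finset (Site 2)) ⊆ W := Finset.singleton_subset_iff.2 hz
  have hx0 : xs 0 = 0 := xs_zero
  have ho : ∀ σ : Fin 2, d (orb 0 σ) = orb (PolySite.pt 0 hz) σ := by
    intro σ
    rw [d_orb, pt_congr_site₄ (xs_mem 0) hz hx0]
  have hf : ∀ σ : Fin 2, d (fb σ) = Orb.embMap (PolySite.incl hΛ) (dΛb σ) := by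
    intro σ
    rw [fb, d_orb, pt_congr_site₄ (xs_mem 0) (hΛ (Finset.mem_singleton_self 0)) hx0]
    rfl
  have hH : termOp d TH = (hubbardTTPrimeFermionInteraction 1 (((-3 / 10 : ℚ)) : ℝ) (((29 / 5 : ℚ)) : ℝ)).localHamiltonian W := by
    rw [TH, termOp_hamTermsIdx 1 (-3 / 10) (29 / 5) xs xs_mem xs_injective xs_cover d d_orb, Rat.cast_one]
  have hE : termOp d TE = fermionEmbed (PolySite.incl (subset_refl W))
      ((hubbardTTPrimeFermionInteraction 1 (((-3 / 10 : ℚ)) : ℝ) (((29 / 5 : ℚ)) : ℝ)).meanEnergyObs 1) := by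
    rw [TE, termOp_energyTermsIdx 1 (-3 / 10) (29 / 5) xs xs_mem (subset_refl W) ix xs_ix_of_mem d d_orb, Rat.cast_one]
  exact affineOrbitLowerRowN_of_kernelCert (-3 / 10) (29 / 5) (by norm_num) hΛ (subset_refl W) (subset_refl W) hz h1 hmul
    d d_injective enc 32 dΛb fb hf (fun p => (ofLex p).2) (fun _ => rfl) TH hH TE hE (fun σ => orb 0 σ) ho TX
    (fun _ => 0) 0 κhi hi κlo lo 0 [] [] (fun l : Fin 0 => l.elim0) (fun l => l.elim0) (fun l : Fin 0 => l.elim0)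
    (fun l : Fin 0 => l.elim0) (fun l : Fin 0 => l.elim0) (fun l => l.elim0) (fun l : Fin 0 => l.elim0) []
    (fun wc hwc => absurd hwc (List.not_mem_nil)) [] (by norm_num) hq

/-- **THE MEAN-ENERGY IDENTITY, KERNEL-REPLAYED**: for every density `x ∈ [0, 2)` and every torus limit `ω` of unit sector ground
states of `hubbardTorusTT' L 1 (−3/10) (29/5)` along `L → ∞`,
`Re ω(Γ(incl) E^{1,−3/10,29/5}_Φ) = energyDensityTT' 1 (−3/10) (29/5) x` — both inequalities through the certificate pipeline (floor
and cap multipliers), the operator identified by the mean-energy dictionary. [cite: BratteliKishimotoRobinson1978, §3 (mean energy functional)] -/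
theorem toy_energy_row (x : ℝ) (hx0 : 0 ≤ x) (hx2 : x < 2) (ω : InfVolFermionState 2) (Ls : ℕ → ℕ)
    (ψ : ∀ L, Fock (Orb (FermionTorus 2 L))) (hLs : Tendsto Ls atTop atTop)
    (hψ : ∀ j, IsGroundStateInSector (hubbardTorusTT' (Ls j) 1 (((-3 / 10 : ℚ)) : ℝ) (((29 / 5 : ℚ)) : ℝ)) (rectN x (Ls j)) 0 (ψ (Ls j)))
    (hψ1 : ∀ j, star (ψ (Ls j)) ⬝ᵥ ψ (Ls j) = 1) (hω : ω.IsTorusLimitOf ψ Ls) :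
    (ω.expect W (fermionEmbed (PolySite.incl (subset_refl W))
        ((hubbardTTPrimeFermionInteraction 1 (((-3 / 10 : ℚ)) : ℝ) (((29 / 5 : ℚ)) : ℝ)).meanEnergyObs 1))).re =
      energyDensityTT' 1 (((-3 / 10 : ℚ)) : ℝ) (((29 / 5 : ℚ)) : ℝ) x := by
  have hE : termOp d TE = fermionEmbed (PolySite.incl (subset_refl W))
      ((hubbardTTPrimeFermionInteraction 1 (((-3 / 10 : ℚ)) : ℝ) (((29 / 5 : ℚ)) : ℝ)).meanEnergyObs 1) := by
    rw [TE, termOp_energyTermsIdx 1 (-3 / 10) (29 / 5) xs xs_mem (subset_refl W) ix xs_ix_of_mem d d_orb, Rat.cast_one]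
  have hlo := affineOrbitLowerRowN_energyOnly TE 0 0 1 (-2) (-2) en_lowerConst_lo x hx0 hx2 ω Ls ψ hLs hψ hψ1 hω
  have hhi := affineOrbitLowerRowN_energyOnly (negT TE) 1 2 0 0 (-2) en_lowerConst_hi x hx0 hx2 ω Ls ψ hLs hψ hψ1 hω
  rw [Finset.sum_singleton, Finset.card_singleton, Nat.cast_one, inv_one, one_mul, ω.expect_fermionEmbed_d4Emb_one_zero]
    at hlo hhi
  rw [termOp_negT, map_neg, Complex.neg_re, hE] at hhi
  rw [hE] at hlo
  push_cast at hlo hhi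
  linarith

end Toy3x3

end CARPolyWindow

end Summit.Ventures.CertifiedManyBodySolver

end
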